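import Literature.AnabelianGeometry.EtaleTheta.LogDivisorModelTateTowerKummerTwistCompatRShearTempered
import Literature.AnabelianGeometry.EtaleTheta.ThetaSubquotientOfTemperedQuotient

/-!
# [EtTh] §5 p.327 at the FOURTH tower model: the Θ̈-KUMMER COORDINATE subgroup `L_Θ ≅ Ẑ` of «GRP₃′»'s compatible part and the
# pinned theta-subquotient stub over `B^temp(Compat₃′)⁰` (Def. 5.4 (b) carrier — class (b) definitions)

Mochizuki, *The étale theta function and its Frobenioid-theoretic manifestations*, Publ. RIMS **45** (2009), §5 p.327 (PDF p.101):
«`(Π^tp_X)^Θ ⊇ l·Δ_Θ` … for `D ∈ Ob(D)`, these subquotients determine subquotients `Aut_D(D) ↠ Aut^Θ_D(D)`; `(l·Δ_Θ)_D ⊆ Aut^Θ_D(D)`»;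
Def. 5.4 (b) p.327 («`(l·Δ_Θ)_S ⊗ ℤ/Nℤ` is of cardinality `N`»); §1 p.238 (PDF p.12) («`Δ_Θ (≅ Ẑ(1))`»); Prop. 1.4 (ii) p.248 (PDF p.22)
(the translation shear).  [cite: MochizukiEtTh2009, §5 p.327 (PDF p.101)]

abc-iut cell, layer L2, seat abc-iut-L2-t4 (gen 9), row «DEF54b-INDEX@FOURTH-MODEL» FILE A (abc-iut-L2-lead R1223 GO; sizing
HOME/staging/L2/L2-t4/g9/census/SIZING-DEF54b-FourthModel.md).  CLASS (b) DEFINITIONS (lane D): three `def`s + their laws; no `instance`,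
no notation, no `Prop`-valued definition, no sorry; nothing landed is edited or restated.  Consumed BY NAME: abc-iut-L1-t6's
shear-semidirect ζ-twisted Kummer–Tate group `Grp 3 thetaShear = K ⋊ (C × ℤ_γ)` and its compatible part `Compat 3 thetaShear ≅ Ẑ(1)³ ⋊ (Ẑˣ × ℤ_γ)`
(`compat`, `resK_apply`, `toAdd_act_apply`, `thetaShearMat`), abc-iut-L2-t9's R2 instance `ThetaSubquotient.thetaSubquotientStub q ι`.

WHAT IS DEFINED / PROVED.  In the compatible group the THIRD Kummer coordinate (`clsTheta = 2`: the classes of the roots of `Θ̈`) is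
preserved by the action: the cyclotomic scalars `χ_n(c)` act diagonally and the shear `σ̄_a = [[1,0,0],[a,1,0],[−a²,−2a,1]]` has third
COLUMN `(0,0,1)` — a class vector supported on the `Θ̈`-coordinate stays supported there.  Hence:
* `compatFam` — the compatible families `(a_n)_n ∈ ∏_n ℤ/M_n` (`res (a_j) = a_i`), an additive group `≅ lim ℤ/(n+2)! ≅ Ẑ`;
* `thetaEmb : Multiplicative ↥compatFam →* Compat 3 thetaShear` — `a ↦ ((0, 0, a), 1)`, the **Θ̈-coordinate subgroup `L_Θ`**, injective
  (`thetaEmb_injective`); `thetaι l := thetaEmb ∘ (·)^l` with range `l·L_Θ`;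
* **`thetaι_range_normal`** — `l·L_Θ` is NORMAL in `Compat₃′`: conjugation by `(k, (c, t))` multiplies a Θ̈-supported family by the
  compatible unit family `χ(c)` (`conj_thetaEmb`); this is the standing hypothesis `[ι.range.Normal]` of the R2 instance;
* `thetaι_mem_vSub_iff` / `thetaEval l n` (`a ↦ l·a_n`) / `preimage_vSub_succ_eq_ker` / `range_thetaEval` / `card_range_thetaEval` — the
  preimage of abc-iut-w5-d034's level subgroup `V_{n+1}` in `Λ` is the kernel of `a ↦ l·a_n`, whose range `l·(ℤ/(n+2)!)` has
  `(n+2)!/gcd((n+2)!, l)` elements;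
* **`thetaStub l : FrobenioidTheta.ThetaSubquotientStub (ConnectedPart (BTemp (Compat 3 thetaShear)))`** — abc-iut-L2-t9's pinned stub at
  `q := id`, `ι := thetaι l`: the fourth model's OWN «`(l·Δ_Θ)_(−)`» in the sense of abc-iut-L2-lead R1198 (the carrier's group supplies
  the Θ̈-Kummer coordinate).  The DECISION of Def. 5.4 (b) at the levels `Y_n = Compat₃′/V_n` is FILE B
  (`Discharge/Sec5Def54bThetaTwistTower.lean`).
HONEST LABEL: a class-(b) combinatorial DESIGN model; `L_Θ` is the Θ̈-Kummer coordinate of OUR tower — a design shadow of a curve's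
`Δ_Θ ≅ Ẑ(1)`, NOT the tempered fundamental group of a Tate curve; an index statement about OUR tower decides nothing about print;
nothing here bears on [IUTchIII] Cor. 3.12 — no side taken; typed ≠ proved; nothing asserts abc proved or refuted.
-/

noncomputable section

namespace Literature.AnabelianGeometry.EtaleTheta

open CategoryTheory Function Literature.AlgebraicGeometry.Frobenioids Literature.AnabelianGeometry.SemiGraphs

namespace TateTowerKummerTwistRShear

namespace ThetaCoord

open TateTowerKummerTwist (M one_lt_M Cst M_dvd res resC)
open TateTowerKummerTwistR (KumAdd Kum resK resK_apply)

/-! ### Compatible families `≅ Ẑ` -/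

/-- **The compatible families `(a_n)_n ∈ ∏_n ℤ/M_n`, `res(a_j) = a_i`** — one coordinate of `Ẑ(1)^r ≤ K_r` (the Kummer classes of ALL
indices of the roots of one function, §1 p.13 «compatible … in `N`»). [cite: MochizukiEtTh2009, §1 p.239 (PDF p.13)] -/
def compatFam : AddSubgroup (∀ n : ℕ, ZMod (M n)) where
  carrier := {a | ∀ i j (h : i ≤ j), res h (a j) = a i}
  zero_mem' := fun i j h => by rw [Pi.zero_apply, Pi.zero_apply, map_zero]
  add_mem' := by
    intro a b ha hb i j h
    rw [Pi.add_apply, Pi.add_apply, map_add, ha i j h, hb i j h]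
  neg_mem' := by
    intro a ha i j h
    rw [Pi.neg_apply, Pi.neg_apply, map_neg, ha i j h]

/-- Membership in `compatFam`. [cite: MochizukiEtTh2009, §1 p.239 (PDF p.13)] -/
theorem mem_compatFam_iff (a : ∀ n : ℕ, ZMod (M n)) : a ∈ compatFam ↔ ∀ i j (h : i ≤ j), res h (a j) = a i := Iff.rfl

/-- The constant INTEGER family `(z mod M_n)_n` is compatible (the dense `ℤ ⊂ Ẑ`). [cite: MochizukiEtTh2009, §1 p.239 (PDF p.13)] -/
theorem intCast_mem_compatFam (z : ℤ) : (fun n => (z : ZMod (M n))) ∈ compatFam := fun _ _ h => map_intCast (res h) z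

/-- The compatible integer family as an element. [cite: MochizukiEtTh2009, §1 p.239 (PDF p.13)] -/
def ofInt (z : ℤ) : ↥compatFam := ⟨fun n => (z : ZMod (M n)), intCast_mem_compatFam z⟩

/-- Its coordinates. [cite: MochizukiEtTh2009, §1 p.239 (PDF p.13)] -/
@[simp] theorem ofInt_apply (z : ℤ) (n : ℕ) : (ofInt z : ∀ n, ZMod (M n)) n = (z : ZMod (M n)) := rfl

/-- Every residue at index `n` is the coordinate of a compatible family (lift an integer representative).
[cite: MochizukiEtTh2009, §1 p.239 (PDF p.13)] -/
theorem exists_compatFam_apply_eq (n : ℕ) (x : ZMod (M n)) : ∃ a : ↥compatFam, (a : ∀ n, ZMod (M n)) n = x := by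
  haveI : NeZero (M n) := ⟨(Nat.factorial_pos _).ne'⟩
  exact ⟨ofInt (x.val : ℤ), by rw [ofInt_apply, Int.cast_natCast, ZMod.natCast_zmod_val]⟩

/-- Scaling a compatible family by a compatible unit family `c ∈ Ẑˣ` (the cyclotomic character values) is compatible.
[cite: MochizukiEtTh2009, §1 p.239 (PDF p.13)] -/
theorem smul_mem_compatFam {c : Cst} (hc : ∀ i j (h : i ≤ j), resC h (c j) = c i) {a : ∀ n, ZMod (M n)} (ha : a ∈ compatFam) :
    (fun n => (c n : ZMod (M n)) * a n) ∈ compatFam := fun i j h => by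
  have hcv : res h (c j : ZMod (M j)) = (c i : ZMod (M i)) := by
    have h1 := congrArg (fun u : (ZMod (M i))ˣ => (u : ZMod (M i))) (hc i j h)
    simpa only [resC, Units.coe_map, RingHom.toMonoidHom_eq_coe, MonoidHom.coe_coe] using h1
  show res h ((c j : ZMod (M j)) * a j) = (c i : ZMod (M i)) * a i
  rw [map_mul, hcv, ha i j h]

/-! ### The Θ̈-coordinate embedding `L_Θ ≤ Compat₃′` -/

/-- The class vector supported on the `Θ̈`-coordinate (`clsTheta = 2`). [cite: MochizukiEtTh2009, §5 p.327 (PDF p.101)] -/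
def thetaVec (a : ∀ n : ℕ, ZMod (M n)) : KumAdd 3 := fun n => Pi.single (2 : Fin 3) (a n)

/-- `thetaVec` is additive. [cite: MochizukiEtTh2009, §5 p.327 (PDF p.101)] -/
def thetaVecHom : (∀ n : ℕ, ZMod (M n)) →+ KumAdd 3 where
  toFun := thetaVec
  map_zero' := funext fun n => by simp [thetaVec]
  map_add' a b := funext fun n => by simp [thetaVec, Pi.single_add]

/-- Restriction of a Θ̈-supported vector is the Θ̈-supported vector of the restriction. [cite: MochizukiEtTh2009, §1 p.239 (PDF p.13)] -/
theorem resK_thetaVec {i j : ℕ} (h : i ≤ j) (a : ∀ n : ℕ, ZMod (M n)) :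
    resK 3 h (thetaVec a j) = Pi.single (2 : Fin 3) (res h (a j)) := by
  funext c
  rw [resK_apply, thetaVec]
  by_cases hc : c = 2
  · subst hc; rw [Pi.single_eq_same, Pi.single_eq_same]
  · rw [Pi.single_eq_of_ne hc, Pi.single_eq_of_ne hc, map_zero]

/-- The shear fixes a Θ̈-supported class vector: the third column of `σ̄_a` is `(0, 0, 1)` (Prop. 1.4 (ii): the translation moves the
classes of `ϖ̈`, `Ü` INTO the `Θ̈`-coordinate, never out of it). [cite: MochizukiEtTh2009, Prop 1.4 (ii) p.248 (PDF p.22)] -/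
theorem mulVec_red_thetaShear_single (n : ℕ) (t : Multiplicative ℤ) (b : ZMod (M n)) :
    Matrix.mulVec (red 3 n (thetaShear t)) (Pi.single (2 : Fin 3) b) = Pi.single (2 : Fin 3) b := by
  ext i
  fin_cases i <;>
    simp [Matrix.mulVec, dotProduct, Fin.sum_univ_three, thetaShearMat, red, RingHom.mapMatrix_apply, Matrix.map_apply]

/-- The action of `(c, t) ∈ C × ℤ_γ` on a Θ̈-supported class vector is the SCALAR `χ_n(c)`. [cite: MochizukiEtTh2009, §1 p.239 (PDF p.13)] -/
theorem act_thetaVec (q : Cst × Multiplicative ℤ) (a : ∀ n : ℕ, ZMod (M n)) :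
    act 3 thetaShear q (Multiplicative.ofAdd (thetaVec a)) =
      Multiplicative.ofAdd (thetaVec fun n => (q.1 n : ZMod (M n)) * a n) := by
  refine Multiplicative.toAdd.injective (funext fun n => ?_)
  rw [toAdd_act_apply, toAdd_ofAdd, toAdd_ofAdd, thetaVec, thetaVec, mulVec_red_thetaShear_single, ← Pi.single_smul,
    smul_eq_mul]

/-- **The Θ̈-coordinate embedding `L_Θ := {((0,0,a), 1)} ≤ Compat₃′`** of the compatible families (print's `Δ_Θ ≅ Ẑ(1)` has, in this
design model, the Θ̈-Kummer coordinate as its shadow). [cite: MochizukiEtTh2009, §5 p.327 (PDF p.101)] -/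
def thetaEmb : Multiplicative ↥compatFam →* Compat 3 thetaShear :=
  ((SemidirectProduct.inl.comp (AddMonoidHom.toMultiplicative (thetaVecHom.comp compatFam.subtype)))).codRestrict
    (compat 3 thetaShear) fun a => by
      refine ⟨fun i j h => ?_, fun i j h => ?_⟩
      · change resK 3 h (thetaVec (a.toAdd : ∀ n, ZMod (M n)) j) = thetaVec (a.toAdd : ∀ n, ZMod (M n)) i
        rw [resK_thetaVec, (a.toAdd).2 i j h]; rfl
      · change resC h ((1 : Cst × Multiplicative ℤ).1 j) = (1 : Cst × Multiplicative ℤ).1 i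
        rw [Prod.fst_one, Pi.one_apply, Pi.one_apply, map_one]

/-- The underlying group element of `thetaEmb a` is `inl (0, 0, a)`. [cite: MochizukiEtTh2009, §5 p.327 (PDF p.101)] -/
theorem coe_thetaEmb (a : Multiplicative ↥compatFam) :
    (thetaEmb a : Grp 3 thetaShear) = SemidirectProduct.inl (Multiplicative.ofAdd (thetaVec (a.toAdd : ∀ n, ZMod (M n)))) := rfl

/-- `thetaEmb` is injective (the Θ̈-coordinate determines the family). [cite: MochizukiEtTh2009, §5 p.327 (PDF p.101)] -/
theorem thetaEmb_injective : Function.Injective thetaEmb := by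
  intro a b hab
  have h := congrArg (fun g : Compat 3 thetaShear => (g : Grp 3 thetaShear).left.toAdd) hab
  simp only [coe_thetaEmb, SemidirectProduct.left_inl, toAdd_ofAdd] at h
  refine Multiplicative.toAdd.injective (Subtype.ext (funext fun n => ?_))
  have hn := congrFun (congrFun h n) (2 : Fin 3)
  simpa only [thetaVec, Pi.single_eq_same] using hn

/-- In a semidirect product with commutative kernel, conjugation of `inl n` by `g` is `inl (φ(g.right) n)`. [folklore] -/
private theorem conj_inl {N G : Type*} [CommGroup N] [Group G] (φ : G →* MulAut N) (g : N ⋊[φ] G) (n : N) :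
    g * SemidirectProduct.inl n * g⁻¹ = SemidirectProduct.inl (φ g.right n) := by
  ext
  · simp only [SemidirectProduct.mul_left, SemidirectProduct.mul_right, SemidirectProduct.inv_left, SemidirectProduct.left_inl,
      SemidirectProduct.right_inl, mul_one, map_inv, MulAut.apply_inv_self]
    rw [mul_comm g.left, mul_assoc, mul_inv_cancel, mul_one]
  · simp only [SemidirectProduct.mul_right, SemidirectProduct.inv_right, SemidirectProduct.right_inl, mul_one, mul_inv_cancel]

/-- **Conjugation acts on `L_Θ` through the cyclotomic scalars**: `g · ((0,0,a),1) · g⁻¹ = ((0,0,χ(c)·a),1)` for `g = (k,(c,t))` — the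
shear contributes nothing on the Θ̈-coordinate and `K` is commutative. [cite: MochizukiEtTh2009, §5 p.327 (PDF p.101)] -/
theorem conj_thetaEmb (g : Compat 3 thetaShear) (a : Multiplicative ↥compatFam) :
    g * thetaEmb a * g⁻¹ =
      thetaEmb (Multiplicative.ofAdd ⟨fun n => ((g : Grp 3 thetaShear).right.1 n : ZMod (M n)) * (a.toAdd : ∀ n, ZMod (M n)) n,
        smul_mem_compatFam g.2.2 (a.toAdd).2⟩) := by
  apply Subtype.ext
  rw [Subgroup.coe_mul, Subgroup.coe_mul, Subgroup.coe_inv, coe_thetaEmb, coe_thetaEmb, toAdd_ofAdd, conj_inl, act_thetaVec]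

/-- `l·L_Θ`: the Θ̈-coordinate embedding precomposed with the `l`-th power (print's `l·Δ_Θ ⊆ Δ_Θ`).
[cite: MochizukiEtTh2009, §5 p.327 (PDF p.101)] -/
def thetaι (l : ℕ) : Multiplicative ↥compatFam →* Compat 3 thetaShear := thetaEmb.comp (powMonoidHom l)

/-- `thetaι l a = thetaEmb (a ^ l)`. [cite: MochizukiEtTh2009, §5 p.327 (PDF p.101)] -/
@[simp] theorem thetaι_apply (l : ℕ) (a : Multiplicative ↥compatFam) : thetaι l a = thetaEmb (a ^ l) := rfl

/-- **`l·L_Θ` is NORMAL in `Compat₃′`** (conjugation rescales by the compatible unit family `χ(c)`, which commutes with `l`-th powers) —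
the standing hypothesis `[ι.range.Normal]` of abc-iut-L2-t9's R2 instance. [cite: MochizukiEtTh2009, §5 p.327 (PDF p.101)] -/
theorem thetaι_range_normal (l : ℕ) : (thetaι l).range.Normal := by
  refine ⟨?_⟩
  rintro _ ⟨a, rfl⟩ g
  refine ⟨Multiplicative.ofAdd ⟨fun n => ((g : Grp 3 thetaShear).right.1 n : ZMod (M n)) * (a.toAdd : ∀ n, ZMod (M n)) n,
    smul_mem_compatFam g.2.2 (a.toAdd).2⟩, ?_⟩
  rw [thetaι_apply, thetaι_apply, conj_thetaEmb]
  congr 1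
  refine Multiplicative.toAdd.injective (Subtype.ext (funext fun n => ?_))
  change (l • (fun n => ((g : Grp 3 thetaShear).right.1 n : ZMod (M n)) * (a.toAdd : ∀ n, ZMod (M n)) n)) n =
    ((g : Grp 3 thetaShear).right.1 n : ZMod (M n)) * (l • (a.toAdd : ∀ n, ZMod (M n))) n
  rw [Pi.smul_apply, Pi.smul_apply, nsmul_eq_mul, nsmul_eq_mul, mul_left_comm]

/-- **The fourth model's theta-subquotient stub** over `B^temp(Compat₃′)⁰`: abc-iut-L2-t9's R2 instance at `q := id`, `ι := l·L_Θ` — the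
carrier's OWN `(l·Δ_Θ)_(−)` (abc-iut-L2-lead R1198: the group supplies the Θ̈-Kummer coordinate).  [cite: MochizukiEtTh2009, §5 p.327 (PDF p.101)] -/
def thetaStub (l : ℕ) : FrobenioidTheta.ThetaSubquotientStub.{0} (ConnectedPart (BTemp (Compat 3 thetaShear))) :=
  haveI := thetaι_range_normal l
  ThetaSubquotient.thetaSubquotientStub (MonoidHom.id (Compat 3 thetaShear)) (thetaι l)

/-- `thetaStub l` IS the R2 instance at `(id, thetaι l)` (definitionally), so all its landed laws apply.
[cite: MochizukiEtTh2009, §5 p.327 (PDF p.101)] -/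
theorem thetaStub_eq (l : ℕ) :
    thetaStub l = (haveI := thetaι_range_normal l;
      ThetaSubquotient.thetaSubquotientStub (MonoidHom.id (Compat 3 thetaShear)) (thetaι l)) := rfl

/-! ### The preimage of the level subgroups `V_n` in `Λ = compatFam` -/

/-- **`ι_l(a) ∈ V_n ⟺ l·a_i = 0 for every index `i < n`** (the element `((0,0,l·a),1)` has trivial translation and trivial character
values; its classes of index `< n` vanish iff the Θ̈-coordinates do). [cite: MochizukiEtTh2009, §5 p.327 (PDF p.101)] -/
theorem thetaι_mem_vSub_iff (l n : ℕ) (a : Multiplicative ↥compatFam) :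
    thetaι l a ∈ vSub 3 thetaShear n ↔ ∀ i < n, (l : ZMod (M i)) * (a.toAdd : ∀ n, ZMod (M n)) i = 0 := by
  rw [mem_vSub_iff, thetaι_apply, coe_thetaEmb]
  simp only [SemidirectProduct.right_inl, SemidirectProduct.left_inl, Prod.snd_one, Prod.fst_one, Pi.one_apply, toAdd_ofAdd,
    true_and, and_true]
  refine forall₂_congr fun i _ => ?_
  rw [thetaVec, Pi.single_eq_zero_iff]
  change (l • (a.toAdd : ∀ n, ZMod (M n))) i = 0 ↔ _
  rw [Pi.smul_apply, nsmul_eq_mul]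

/-- The evaluation `a ↦ l·a_n : Λ → ℤ/M_n` (index-`n` class of the `l`-th power), as a homomorphism of multiplicative groups.
[cite: MochizukiEtTh2009, §5 p.327 (PDF p.101)] -/
def thetaEval (l n : ℕ) : Multiplicative ↥compatFam →* Multiplicative (ZMod (M n)) :=
  AddMonoidHom.toMultiplicative
    ((DistribSMul.toAddMonoidHom (ZMod (M n)) (l : ZMod (M n))).comp
      ((Pi.evalAddMonoidHom (fun n => ZMod (M n)) n).comp compatFam.subtype))

/-- `thetaEval` evaluated. [cite: MochizukiEtTh2009, §5 p.327 (PDF p.101)] -/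
@[simp] theorem toAdd_thetaEval (l n : ℕ) (a : Multiplicative ↥compatFam) :
    (thetaEval l n a).toAdd = (l : ZMod (M n)) * (a.toAdd : ∀ n, ZMod (M n)) n := rfl

/-- At level `n+1`, by compatibility, **`ι_l(a) ∈ V_{n+1} ⟺ l·a_n = 0 in ℤ/(n+2)!`**: the preimage `ι_l⁻¹(V_{n+1} ∩ l·L_Θ)` is the kernel of
`thetaEval l n`. [cite: MochizukiEtTh2009, §5 p.327 (PDF p.101)] -/
theorem preimage_vSub_succ_eq_ker (l n : ℕ) :
    (((vOpenNormal 3 thetaShear (n + 1)).toSubgroup.map (MonoidHom.id (Compat 3 thetaShear)) ⊓ (thetaι l).range).comap (thetaι l)) =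
      (thetaEval l n).ker := by
  ext a
  rw [Subgroup.mem_comap, Subgroup.mem_inf, Subgroup.map_id, vOpenNormal_toSubgroup, MonoidHom.mem_ker, thetaι_mem_vSub_iff]
  constructor
  · rintro ⟨h, -⟩
    exact Multiplicative.toAdd.injective ((toAdd_thetaEval l n a).trans (h n (Nat.lt_succ_self n)))
  · intro h
    refine ⟨fun i hi => ?_, ⟨a, rfl⟩⟩
    have hin : i ≤ n := Nat.lt_succ_iff.mp hi
    have hn : (l : ZMod (M n)) * (a.toAdd : ∀ n, ZMod (M n)) n = 0 :=
      (toAdd_thetaEval l n a).symm.trans (congrArg Multiplicative.toAdd h)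
    rw [← (a.toAdd).2 i n hin, ← map_natCast (res hin) l, ← map_mul, hn, map_zero]

/-- **The range of `a ↦ l·a_n` is `l·(ℤ/M_n)`**, the multiples of `l` (every residue is the `n`-th coordinate of a compatible family).
[cite: MochizukiEtTh2009, §5 p.327 (PDF p.101)] -/
theorem range_thetaEval (l n : ℕ) :
    (thetaEval l n).range = (AddSubgroup.zmultiples (l : ZMod (M n))).toSubgroup := by
  haveI : NeZero (M n) := ⟨(Nat.factorial_pos _).ne'⟩
  ext y
  constructor
  · rintro ⟨a, rfl⟩
    change (thetaEval l n a).toAdd ∈ AddSubgroup.zmultiples (l : ZMod (M n))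
    rw [toAdd_thetaEval, mul_comm, ← ZMod.natCast_zmod_val ((a.toAdd : ∀ n, ZMod (M n)) n), ← nsmul_eq_mul]
    exact AddSubgroup.nsmul_mem_zmultiples _ _
  · intro hy
    change y.toAdd ∈ AddSubgroup.zmultiples (l : ZMod (M n)) at hy
    obtain ⟨k, hk⟩ := AddSubgroup.mem_zmultiples_iff.mp hy
    obtain ⟨a, ha⟩ := exists_compatFam_apply_eq n (k : ZMod (M n))
    refine ⟨Multiplicative.ofAdd a, Multiplicative.toAdd.injective ?_⟩
    rw [toAdd_thetaEval, toAdd_ofAdd, ha, ← hk, zsmul_eq_mul, mul_comm]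

/-- `#(l·(ℤ/M_n)) = M_n / gcd(M_n, l)`. [cite: MochizukiEtTh2009, §5 p.327 (PDF p.101)] -/
theorem card_range_thetaEval (l n : ℕ) : Nat.card (thetaEval l n).range = M n / Nat.gcd (M n) l := by
  haveI : NeZero (M n) := ⟨(Nat.factorial_pos _).ne'⟩
  rw [range_thetaEval]
  change Nat.card {x : Multiplicative (ZMod (M n)) // x.toAdd ∈ AddSubgroup.zmultiples (l : ZMod (M n))} = _
  rw [Nat.card_congr (Equiv.subtypeEquiv (p := fun x : Multiplicative (ZMod (M n)) => x.toAdd ∈ AddSubgroup.zmultiples (l : ZMod (M n)))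
    (q := fun b : ZMod (M n) => b ∈ AddSubgroup.zmultiples (l : ZMod (M n))) Multiplicative.toAdd fun _ => Iff.rfl),
    Nat.card_zmultiples, ZMod.addOrderOf_coe _ (NeZero.ne (M n))]

end ThetaCoord

end TateTowerKummerTwistRShear

end Literature.AnabelianGeometry.EtaleTheta

end
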